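import Summits.BirchSwinnertonDyer.Rank1Residual.Additive.GordAnomalousResidueFour
import Summits.BirchSwinnertonDyer.Rank1Residual.Additive.SpecialJTraceCongruenceZero
import HarnessLib

/-!
# The ANOMALOUS BIT on defect `3`/`6` is ONE RESIDUE of Cremona's `c₆` (gen 35's LAW 7 as a theorem):
# `ReductionNonAnomalous W p` DECIDED on the whole defect-`3`/`6` (G)-cell

HONEST FRAMING (cell `b2b-bsdres`, run/shared/lean/b2b/bsd-rank1-residual/, verbatim in every
file): the goal of the cell is to DELETE the COMBINATION-SHAPED residual classes of the
Birch–Swinnerton-Dyer formula for ALL analytic-rank `≤ 1` elliptic curves over `ℚ` — "full BSD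
formula for every rank `≤ 1` curve in class `C`" assembled STRICTLY from published theorems — so
that the rank-`≤ 1` remainder becomes exactly the CONSTRUCTION-SHAPED classes, which are TYPED
(missing-input `Prop`s), NOT attempted. This is not "finishing BSD". Sub-cell `additive-p2`
(X3♯(G-ord) / X4♯(G-ord)), generation 36, part 5: research route; no claim beyond the stated
classes; theorems only, no definition, no named fact, nothing booked, no label moved.

## What is proved

`W` a globally minimal model of `E/ℚ` with `3 ∣ e_E(p)` (Kodaira `II`, `IV`, `IV*`, `II*`), `p ≥ 5`,
`3 ∣ p − 1`, and `c₆(E) = n·(−p)^v` with `p ∤ n` (Cremona: `v = v_p(c₆)`, `n = c₆/(−p)^v`; part 3).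

* **`intCast_trace_reductionAt_eq_and_dvd_iff_of_three_dvd_semistabilityIndex`** (`K` a `p`-th
  cyclotomic field, `𝔭 ∋ p` good for `E_K`): in `k_𝔭 = 𝔽_p`,
  **`p + 1 − #Ẽ_𝔭 = C((p−1)/2,(p−1)/3)·(−n/864)^{(p−1)/6}`** and
  **`p ∣ #Ẽ_𝔭(𝔽_p) ⟺ C((p−1)/2,(p−1)/3)·(−n/864)^{(p−1)/6} = 1` in `ZMod p`** (census LAW 7, 334/334);
* **`reductionNonAnomalous_iff_of_three_dvd_semistabilityIndex`** — on the type-(G) locus with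
  `3 ∣ e_E(p)`: **`Delbourgo2002.ReductionNonAnomalous W p ⟺ ¬(C((p−1)/2,(p−1)/3)·(−n/864)^{(p−1)/6}
  = 1 in ZMod p)`** (every (G)-field place lifts to `ℚ(ζ_p)`, part 4's
  `exists_heightOneSpectrum_cyclotomic_over`); with gen 34 (never anomalous at non-capable `p`,
  `4p ≠ 3m² + 1`) Delbourgo's `ℓ_p(E)` proviso on the defect-`3`/`6` cell is decided by `p` and this
  residue;
* `p = 7`: **`seven_dvd_natCard_point_reductionAt_iff_intCast_modEq_neg_one`** (`7 ∣ #Ẽ_𝔭(𝔽_7) ⟺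
  n ≡ −1 (mod 7)`; `C(3,2)·(−n/864) = −n` in `𝔽_7`) and
  **`reductionNonAnomalous_seven_iff_of_three_dvd_semistabilityIndex`** (`ReductionNonAnomalous W 7 ⟺
  ¬ n ≡ −1 (mod 7)`, Kodaira `II, IV, IV*, II*` at `7`; census: 50/50 anomalous rows at `7` have
  `c₆/(−7)^{v} ≡ 6`, 0/211 otherwise; at `19`: anomalous iff `n³ ≡ 11`, 4/4 vs 0/8).

* census forms (no number field in the statement): **`reductionNonAnomalous_five_iff_c₄_div_not_modEq_one`**
  (`TypeG W 5`, `e_E(5) = 4`: `ReductionNonAnomalous W 5 ⟺ c₄(E_ℤ)/(−5)^{v_5} ≢ 1 (mod 5)`) and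
  **`reductionNonAnomalous_seven_iff_c₆_div_not_modEq_neg_one`** (`TypeG W 7`, `3 ∣ e_E(7)`:
  `ReductionNonAnomalous W 7 ⟺ c₆(E_ℤ)/(−7)^{v_7} ≢ −1 (mod 7)`), `E_ℤ = integralModelInt W`.

With gen 21 (defect `2`: `a_p(E^{(p*)}) = 1`) and part 4 (defect `4`), the anomalous bit of EVERY pair of
the (G)-cell — the hypothesis `ReductionNonAnomalous` of Delbourgo's Theorem (B) clause 3 — is a theorem-
level function of `p` and ONE residue of Cremona's `(c₄, c₆)`.

References: D. Delbourgo, J. Number Theory 95 (2002) p. 39 (`ℓ_p(E)`); B. Mazur, Invent. Math. 18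
(1972) §5; K. Ireland, M. Rosen, GTM 84, Ch. 18 §3 Thm. 4; J. H. Silverman, *AEC* VII.1.3(b),
V.4.1(a).
-/

noncomputable section

open scoped Classical NumberField

open WeierstrassCurve IsDedekindDomain IsDedekindDomain.HeightOneSpectrum NumberField IsLocalRing
  Literature.NumberTheory.EllipticCurves Literature.NumberTheory.EllipticCurves.Rank1Residual

namespace Summit.BirchSwinnertonDyer.Rank1Residual.Additive

section ThreeSix

variable (W : WeierstrassCurve ℚ) [W.IsElliptic] [W.IsGloballyMinimal] (p : ℕ) [hp : Fact p.Prime]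

omit [W.IsElliptic] [W.IsGloballyMinimal] in
/-- `p ≥ 5` prime with `3 ∣ p − 1` has `6 ∣ p − 1`. [folklore] -/
theorem six_dvd_sub_one_of_three_dvd (hp5 : 5 ≤ p) (h3 : 3 ∣ p - 1) : 6 ∣ p - 1 := by
  have h2 : 2 ∣ p - 1 := by
    rcases hp.out.eq_two_or_odd with h | h
    · omega
    · omega
  have := Nat.Coprime.mul_dvd_of_dvd_of_dvd (by norm_num : Nat.Coprime 2 3) h2 h3
  simpa using this

/-- **LAW 7 (defect `3`/`6`): the trace and the anomalous bit are one sextic residue of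
`c₆/(−p)^v`.** Let `W` be globally minimal, `p ≥ 5`, `3 ∣ p − 1`, `3 ∣ e_E(p)`, `K` a `p`-th
cyclotomic field, `𝔭 ∋ p` good for `E_K`, and `c₆(E) = n·(−p)^v` with `p ∤ n`. Then in `k_𝔭 = 𝔽_p`:
**`p + 1 − #Ẽ_𝔭 = C((p−1)/2,(p−1)/3)·(−n/864)^{(p−1)/6}`**, and
**`p ∣ #Ẽ_𝔭(𝔽_p) ⟺ C((p−1)/2,(p−1)/3)·(−n/864)^{(p−1)/6} = 1` in `ZMod p`** (census 334/334).
[cite: IrelandRosen1990, Ch. 18 §3, Theorem 4] -/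
theorem intCast_trace_reductionAt_eq_and_dvd_iff_of_three_dvd_semistabilityIndex (hp5 : 5 ≤ p)
    (h3 : 3 ∣ p - 1) (h3e : 3 ∣ semistabilityIndex W p)
    {K : Type} [Field K] [NumberField K] [IsCyclotomicExtension {p} ℚ K]
    {𝔭 : HeightOneSpectrum (𝓞 K)} (h𝔭 : (p : 𝓞 K) ∈ 𝔭.asIdeal)
    (hgood : (W.baseChange K).HasGoodReductionAt 𝔭) {n : ℤ} {v : ℕ} (hpn : ¬ (p : ℤ) ∣ n)
    (hn : W.c₆ = n * (-(p : ℚ)) ^ v) :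
    (((p : ℤ) + 1 - Nat.card ((W.baseChange K).reductionAt 𝔭).toAffine.Point : ℤ) :
        ResidueField (𝔭.adicCompletionIntegers K)) =
      ((((p - 1) / 2).choose ((p - 1) / 3) : ℕ) : ResidueField (𝔭.adicCompletionIntegers K)) *
        (-(n : ResidueField (𝔭.adicCompletionIntegers K)) / 864) ^ ((p - 1) / 6) ∧
    (p ∣ Nat.card ((W.baseChange K).reductionAt 𝔭).toAffine.Point ↔
      ((((p - 1) / 2).choose ((p - 1) / 3) : ℕ) : ZMod p) * (-(n : ZMod p) / 864) ^ ((p - 1) / 6) = 1) := by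
  haveI : (W.baseChange K).IsElliptic := by rw [baseChange]; infer_instance
  haveI : ((W.baseChange K).reductionAt 𝔭).IsElliptic := isElliptic_reductionAt hgood
  obtain ⟨𝔭₀, -, huniq, hN⟩ := exists_prime_over_prime p K
  have h𝔭₀ : 𝔭 = 𝔭₀ := by
    have : 𝔭 ∈ ({𝔭₀} : Set (HeightOneSpectrum (𝓞 K))) := by rw [← huniq]; exact_mod_cast h𝔭
    exact this
  subst h𝔭₀
  have hcard := natCard_residueField_adicCompletionIntegers_eq_of_absNorm 𝔭 hN
  obtain ⟨t, ht0, ht⟩ :=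
    exists_reductionAt_c₆_eq_pow_six_mul_intCast_of_three_dvd_semistabilityIndex W p hp5 h3 h3e h𝔭
      hgood hpn hn
  have ht6 : (t ^ 6) ^ ((p - 1) / 6) = 1 :=
    pow_pow_div_eq_one_of_natCard_eq p hcard (six_dvd_sub_one_of_three_dvd p hp5 h3) ht0
  have hj : ((W.baseChange K).reductionAt 𝔭).j = 0 :=
    reductionAt_j_eq_zero (W.baseChange K) 𝔭 hgood
      (valuation_j_lt_one_of_three_dvd_semistabilityIndex W p h3e h𝔭 hgood)
  have key := SpecialJ.intCast_trace_eq_choose_mul_pow_of_j_eq_zero ((W.baseChange K).reductionAt 𝔭)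
    hp.out hp5 h3 hcard hj
  have hpow : (-((W.baseChange K).reductionAt 𝔭).c₆ / 864) ^ ((p - 1) / 6) =
      (-(n : ResidueField (𝔭.adicCompletionIntegers K)) / 864) ^ ((p - 1) / 6) := by
    rw [ht, show -(t ^ 6 * (n : ResidueField (𝔭.adicCompletionIntegers K))) / 864 =
      t ^ 6 * (-(n : ResidueField (𝔭.adicCompletionIntegers K)) / 864) by ring, mul_pow, ht6, one_mul]
  rw [hpow] at key
  haveI := Fintype.ofFinite (ResidueField (𝔭.adicCompletionIntegers K))
  obtain ⟨hchar, -⟩ := SpecialJ.ringChar_eq_of_natCard_eq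
    (k := ResidueField (𝔭.adicCompletionIntegers K)) hp.out hcard
  haveI : CharP (ResidueField (𝔭.adicCompletionIntegers K)) p := hchar ▸ ringChar.charP _
  exact ⟨key, (dvd_iff_of_intCast_trace_eq p key).trans (natCast_mul_pow_eq_one_iff_zmod p _ _ _ _)⟩

/-- **`ReductionNonAnomalous W p` on the defect-`3`/`6` cell is ONE residue of Cremona's `c₆`.** On
the type-(G) locus with `3 ∣ e_E(p)` (`p ≥ 5`; then `3 ∣ p − 1`) and `c₆(E) = n·(−p)^v`, `p ∤ n`:
**`Delbourgo2002.ReductionNonAnomalous W p ⟺ ¬(C((p−1)/2,(p−1)/3)·(−n/864)^{(p−1)/6} = 1 in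
ZMod p)`** — every (G)-field place lifts to `ℚ(ζ_p)` with the same point count. Together with gen 34
(non-capable `p`) and gen 21 / part 4 (defects `2`, `4`) the proviso of Delbourgo's Theorem (B) is
decided on the whole (G)-cell by `p` and one residue of `(c₄, c₆)`.
[cite: Delbourgo2002, p. 39 (definition of ℓ_p(E))] -/
theorem reductionNonAnomalous_iff_of_three_dvd_semistabilityIndex (hp5 : 5 ≤ p) (hG : TypeG W p)
    (h3e : 3 ∣ semistabilityIndex W p) {n : ℤ} {v : ℕ} (hpn : ¬ (p : ℤ) ∣ n)
    (hn : W.c₆ = n * (-(p : ℚ)) ^ v) :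
    Delbourgo2002.ReductionNonAnomalous W p ↔
      ¬ ((((p - 1) / 2).choose ((p - 1) / 3) : ℕ) : ZMod p) * (-(n : ZMod p) / 864) ^ ((p - 1) / 6) = 1 := by
  have h3 := three_dvd_sub_one_of_typeG_of_three_dvd_semistabilityIndex W p hp5 hG h3e
  constructor
  · intro hR hcong
    obtain ⟨L, _, _, _, F, hF⟩ := hG
    haveI : NumberField F := NumberField.of_module_finite ℚ F
    obtain ⟨w, hw⟩ := exists_heightOneSpectrum_natCast_mem F p
    have hgood := hF w hw
    obtain ⟨𝔓, h𝔓, hgoodL, hcount⟩ := exists_heightOneSpectrum_cyclotomic_over p W F w hw hgood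
    have hdvd := (intCast_trace_reductionAt_eq_and_dvd_iff_of_three_dvd_semistabilityIndex W p hp5 h3
      h3e h𝔓 hgoodL hpn hn).2.mpr hcong
    rw [hcount] at hdvd
    exact hR L F w hw hgood hdvd
  · intro hcong L _ _ _ F w hw hgood hdvd
    obtain ⟨𝔓, h𝔓, hgoodL, hcount⟩ := exists_heightOneSpectrum_cyclotomic_over p W F w hw hgood
    rw [← hcount] at hdvd
    exact hcong ((intCast_trace_reductionAt_eq_and_dvd_iff_of_three_dvd_semistabilityIndex W p hp5 h3
      h3e h𝔓 hgoodL hpn hn).2.mp hdvd)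

/-! ### `p = 7` -/

/-- **LAW 7 at `p = 7`: anomalous iff `c₆/(−7)^v ≡ −1 (mod 7)`.** `W` globally minimal with
`3 ∣ e_E(7)`, `K` a `7`-th cyclotomic field, `𝔭 ∋ 7` good for `E_K`, `c₆(E) = n·(−7)^v`, `7 ∤ n`:
**`7 ∣ #Ẽ_𝔭(𝔽_7) ⟺ n ≡ −1 (mod 7)`** (`C(3,2)·(−n/864) = −n` in `𝔽_7` since `864 ≡ 3`; census: 50/50
anomalous rows at `7` have `c₆/(−7)^v ≡ 6`, 0/211 otherwise). [cite: IrelandRosen1990, Ch. 18 §3, Theorem 4] -/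
theorem seven_dvd_natCard_point_reductionAt_iff_intCast_modEq_neg_one [h7 : Fact (Nat.Prime 7)]
    (h3e : 3 ∣ semistabilityIndex W 7) {K : Type} [Field K] [NumberField K]
    [IsCyclotomicExtension {7} ℚ K] {𝔭 : HeightOneSpectrum (𝓞 K)}
    (h𝔭 : ((7 : ℕ) : 𝓞 K) ∈ 𝔭.asIdeal) (hgood : (W.baseChange K).HasGoodReductionAt 𝔭) {n : ℤ}
    {v : ℕ} (hpn : ¬ (7 : ℤ) ∣ n) (hn : W.c₆ = n * (-(7 : ℚ)) ^ v) :
    7 ∣ Nat.card ((W.baseChange K).reductionAt 𝔭).toAffine.Point ↔ n ≡ -1 [ZMOD 7] := by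
  haveI : (W.baseChange K).IsElliptic := by rw [baseChange]; infer_instance
  obtain ⟨𝔭₀, -, huniq, hN⟩ := exists_prime_over_prime 7 K
  have h𝔭₀ : 𝔭 = 𝔭₀ := by
    have : 𝔭 ∈ ({𝔭₀} : Set (HeightOneSpectrum (𝓞 K))) := by rw [← huniq]; exact_mod_cast h𝔭
    exact this
  subst h𝔭₀
  have hcard := natCard_residueField_adicCompletionIntegers_eq_of_absNorm 𝔭 hN
  haveI := Fintype.ofFinite (ResidueField (𝔭.adicCompletionIntegers K))
  obtain ⟨hchar, -⟩ := SpecialJ.ringChar_eq_of_natCard_eq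
    (k := ResidueField (𝔭.adicCompletionIntegers K)) h7.out hcard
  haveI : CharP (ResidueField (𝔭.adicCompletionIntegers K)) 7 := hchar ▸ ringChar.charP _
  obtain ⟨key, -⟩ := intCast_trace_reductionAt_eq_and_dvd_iff_of_three_dvd_semistabilityIndex W 7
    (by norm_num) (by norm_num) h3e h𝔭 hgood (by exact_mod_cast hpn) hn
  -- in `𝔽_7`: `C(3,2) = 3`, `864 = 3`, so the right-hand side is `−n`
  have h3ne : (3 : ResidueField (𝔭.adicCompletionIntegers K)) ≠ 0 := by
    rw [show (3 : ResidueField (𝔭.adicCompletionIntegers K)) = ((3 : ℕ) : _) by norm_cast, Ne,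
      CharP.cast_eq_zero_iff _ 7]
    norm_num
  have h864 : (864 : ResidueField (𝔭.adicCompletionIntegers K)) = 3 := by
    rw [show (864 : ResidueField (𝔭.adicCompletionIntegers K)) = ((864 : ℕ) : _) by norm_cast,
      CharP.cast_eq_mod (ResidueField (𝔭.adicCompletionIntegers K)) 7 864]
    norm_num
  have hrhs : ((((7 - 1) / 2).choose ((7 - 1) / 3) : ℕ) : ResidueField (𝔭.adicCompletionIntegers K)) *
      (-(n : ResidueField (𝔭.adicCompletionIntegers K)) / 864) ^ ((7 - 1) / 6) =
        -(n : ResidueField (𝔭.adicCompletionIntegers K)) := by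
    have h6 : (7 - 1) / 6 = 1 := rfl
    have hc : ((7 - 1) / 2).choose ((7 - 1) / 3) = 3 := by decide
    rw [h6, pow_one, hc, h864, Nat.cast_ofNat, mul_div_assoc', mul_comm, mul_div_assoc, div_self h3ne,
      mul_one]
  rw [hrhs] at key
  rw [dvd_iff_of_intCast_trace_eq 7 key, neg_eq_iff_eq_neg, ← Int.cast_one, ← Int.cast_neg,
    CharP.intCast_eq_intCast (ResidueField (𝔭.adicCompletionIntegers K)) 7]
  simp only [Nat.cast_ofNat]

/-- **`ReductionNonAnomalous W 7` on the defect-`3`/`6` cell (Kodaira `II, IV, IV*, II*` at `7`):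
`⟺ c₆/(−7)^v ≢ −1 (mod 7)`.** On the type-(G) locus at `p = 7` with `3 ∣ e_E(7)` and
`c₆(E) = n·(−7)^v`, `7 ∤ n`: **`Delbourgo2002.ReductionNonAnomalous W 7 ⟺ ¬ n ≡ −1 (mod 7)`**.
[cite: Delbourgo2002, p. 39 (definition of ℓ_p(E))] -/
theorem reductionNonAnomalous_seven_iff_of_three_dvd_semistabilityIndex [h7 : Fact (Nat.Prime 7)]
    (hG : TypeG W 7) (h3e : 3 ∣ semistabilityIndex W 7) {n : ℤ} {v : ℕ} (hpn : ¬ (7 : ℤ) ∣ n)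
    (hn : W.c₆ = n * (-(7 : ℚ)) ^ v) :
    Delbourgo2002.ReductionNonAnomalous W 7 ↔ ¬ n ≡ -1 [ZMOD 7] := by
  constructor
  · intro hR hmod
    obtain ⟨L, _, _, _, F, hF⟩ := hG
    haveI : NumberField F := NumberField.of_module_finite ℚ F
    obtain ⟨w, hw⟩ := exists_heightOneSpectrum_natCast_mem F 7
    have hgood := hF w hw
    obtain ⟨𝔓, h𝔓, hgoodL, hcount⟩ := exists_heightOneSpectrum_cyclotomic_over 7 W F w hw hgood
    have hdvd := (seven_dvd_natCard_point_reductionAt_iff_intCast_modEq_neg_one W h3e h𝔓 hgoodL hpn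
      hn).mpr hmod
    rw [hcount] at hdvd
    exact hR L F w hw hgood hdvd
  · intro hmod L _ _ _ F w hw hgood hdvd
    obtain ⟨𝔓, h𝔓, hgoodL, hcount⟩ := exists_heightOneSpectrum_cyclotomic_over 7 W F w hw hgood
    rw [← hcount] at hdvd
    exact hmod ((seven_dvd_natCard_point_reductionAt_iff_intCast_modEq_neg_one W h3e h𝔓 hgoodL hpn
      hn).mp hdvd)


/-! ### Census forms: the residue read off Cremona's integers `c₄`, `c₆` of the minimal model -/

/-- **Census form at `p = 5` (defect `4`)**: on the type-(G) locus with `e_E(5) = 4`,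
**`ReductionNonAnomalous W 5 ⟺ c₄/(−5)^{v_5(c₄)} ≢ 1 (mod 5)`** with `c₄ = c₄(E_ℤ)` the integer of the
minimal model (`integralModelInt`) and `v_5 = padicValInt 5` — no number field, no reduction, one
residue (census: 163/233 rows). [cite: Delbourgo2002, p. 39 (definition of ℓ_p(E))] -/
theorem reductionNonAnomalous_five_iff_c₄_div_not_modEq_one [h5 : Fact (Nat.Prime 5)]
    (hG : TypeG W 5) (he : semistabilityIndex W 5 = 4) :
    Delbourgo2002.ReductionNonAnomalous W 5 ↔
      ¬ (integralModelInt W).c₄ / (-5 : ℤ) ^ padicValInt 5 (integralModelInt W).c₄ ≡ 1 [ZMOD 5] := by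
  obtain ⟨L, _, _, _, F, hF⟩ := id hG
  haveI : NumberField F := NumberField.of_module_finite ℚ F
  obtain ⟨w, hw⟩ := exists_heightOneSpectrum_natCast_mem F 5
  obtain ⟨n, hpn, hn, -⟩ :=
    exists_c₄_eq_mul_neg_pow_of_semistabilityIndex_eq_four W 5 le_rfl he hw (hF w hw)
  have hc : W.c₄ = ((integralModelInt W).c₄ : ℚ) := by
    have h := (integralModelInt W).map_c₄ (Int.castRingHom ℚ)
    rw [map_integralModelInt, eq_intCast] at h
    exact h
  set v := padicValInt 5 (integralModelInt W).c₄ with hv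
  have hint : (integralModelInt W).c₄ = n * (-5 : ℤ) ^ v := by
    have h : ((integralModelInt W).c₄ : ℚ) = ((n * (-5 : ℤ) ^ v : ℤ) : ℚ) := by
      rw [← hc, hn]; push_cast; ring
    exact_mod_cast h
  have hdiv : (integralModelInt W).c₄ / (-5 : ℤ) ^ v = n := by
    rw [hint, Int.mul_ediv_cancel _ (pow_ne_zero _ (by norm_num))]
  rw [hdiv]
  exact reductionNonAnomalous_five_iff_of_semistabilityIndex_eq_four W hG he hpn hn

/-- **Census form at `p = 7` (defect `3`/`6`)**: on the type-(G) locus with `3 ∣ e_E(7)`,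
**`ReductionNonAnomalous W 7 ⟺ c₆/(−7)^{v_7(c₆)} ≢ −1 (mod 7)`** with `c₆ = c₆(E_ℤ)` the integer of the
minimal model (census: 211/261 rows). [cite: Delbourgo2002, p. 39 (definition of ℓ_p(E))] -/
theorem reductionNonAnomalous_seven_iff_c₆_div_not_modEq_neg_one [h7 : Fact (Nat.Prime 7)]
    (hG : TypeG W 7) (h3e : 3 ∣ semistabilityIndex W 7) :
    Delbourgo2002.ReductionNonAnomalous W 7 ↔
      ¬ (integralModelInt W).c₆ / (-7 : ℤ) ^ padicValInt 7 (integralModelInt W).c₆ ≡ -1 [ZMOD 7] := by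
  obtain ⟨L, _, _, _, F, hF⟩ := id hG
  haveI : NumberField F := NumberField.of_module_finite ℚ F
  obtain ⟨w, hw⟩ := exists_heightOneSpectrum_natCast_mem F 7
  obtain ⟨n, hpn, hn, -⟩ :=
    exists_c₆_eq_mul_neg_pow_of_three_dvd_semistabilityIndex W 7 (by norm_num) h3e hw (hF w hw)
  have hc : W.c₆ = ((integralModelInt W).c₆ : ℚ) := by
    have h := (integralModelInt W).map_c₆ (Int.castRingHom ℚ)
    rw [map_integralModelInt, eq_intCast] at h
    exact h
  set v := padicValInt 7 (integralModelInt W).c₆ with hv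
  have hint : (integralModelInt W).c₆ = n * (-7 : ℤ) ^ v := by
    have h : ((integralModelInt W).c₆ : ℚ) = ((n * (-7 : ℤ) ^ v : ℤ) : ℚ) := by
      rw [← hc, hn]; push_cast; ring
    exact_mod_cast h
  have hdiv : (integralModelInt W).c₆ / (-7 : ℤ) ^ v = n := by
    rw [hint, Int.mul_ediv_cancel _ (pow_ne_zero _ (by norm_num))]
  rw [hdiv]
  exact reductionNonAnomalous_seven_iff_of_three_dvd_semistabilityIndex W hG h3e hpn hn

end ThreeSix

end Summit.BirchSwinnertonDyer.Rank1Residual.Additive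

end
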